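import Literature.IUT.HodgeArakelov.LabelClassesOfCuspsCor24iClosure
import Literature.IUT.HodgeArakelov.PlusMinusTowerStableCurveBridge
import HarnessLib

/-!
# [IUTchII] Cor 2.4 (i), input (B): the BRIDGE from per-level [IUTchI] §2 data (side `Π̂_{X_v}`) to the binder `h23vi`

S. Mochizuki, *Inter-universal Teichmüller theory II*, kurims manuscript (Dec. 2020) §2, Cor 2.4 (i), proof p.70 l.−2 –
p.71 l.3: "by applying the equivalence of [IUTchI], Corollary 2.3, (vi) [cf. also [CombGC], Proposition 1.2, (ii)], to
the various finite index open subgroups of `Δ^±_v`, it follows that `γ' ∈ Δ̂^±_{v□}`"; *… I*, §2, Cor 2.3 pp.47–49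
[cite: Mochizuki2012, II Cor 2.4 (i) pp.70-71] (claim key DISPUTED, D-0012; every statement of the series below is a
HYPOTHESIS; nothing is asserted).  PROOF-ONLY file (abc-iut cell, wave 5, seat abc-iut-w5-d121; node
**IUTchII:Cor2.4(i)** input (B) = GAP-LEDGER G-w4d012-2; sub-DAG `plan/L5/SUBDAG-IUTchI-Cor23Levels.md` =
`plan/L6/SUBDAG-IUTchII-Cor-24i-B.md`, row "TRANSLATION … is L6's (w5-d121 …)" of abc-iut-L5-lead's RULINGS #5
2026-08-26T01:55Z; no definitions).

WHAT IT DOES.  `PlusMinusTower.h23vi_of_levelwise` (abc-iut-w5-d121, p414651) reduces `h23vi` to a PER-LEVEL statement in the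
tower's language; abc-iut-w5-d132's `LabelClassesOfCuspsCor24iLevelCore` (p416078) derives that statement from five
per-level inputs, still in the tower's language.  The [IUTchI] §2 side (abc-iut-L5-t11's forthcoming
`TemperedCoveringsCor23LevelsSub`, rows B0–B4-L5) speaks about `Π̂_{X_v} = D.PiHat` acting on the vertices of the dual
graph of a level-`i` covering.  This file is the TRANSLATION between the two along abc-iut-L6-t7's agreement B13
(`StableCurveAgreement`: `eHat : Π̂^±_v ⥲ Π̂_{X_v}`, with the `Π`- and `Δ`-level `ℍ`-dictionaries for the target
`Π_{v□}`): `StableCurveAgreement.h23vi_of_piHatLevelData` takes the per-level data ON THE `D.PiHat` SIDE —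
levels `U'_i ≤ Π̂_{X_v}`, a `Π̂_{X_v}`-action on the level-`i` vertex type `V_i`, the component `□̃_i` (`comp i`) with the
base vertex `c_i` of the cusp of `I_t` (`base`), and the three printed inputs for TEMPERED GEOMETRIC elements
`g' ∈ ι(Π^tp_{X_v}) ∩ Δ̂_{X_v}`: `incD` ([IUTchI] Cor 2.3 (vi) at level `i` after the commensurator step (i)/(iv):
`(ê I)^{g'} ⊆ ι(Π^tp_{X,ℍ})` ⇒ `g'·c_i ∈ □̃_i`), `blkD` (components of the inverse image of `□` are blocks), `stabD`
(`Stab(□̃_i) ⊆ ι(Δ^tp_{X,ℍ})·U'_i`) — and returns the binder `h23vi` of abc-iut-w4-d012's `cor24_i_of_inputs` for the levels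
pulled back to `Π̂^cor_v`.  `levels_hbasis_of_piHat` transports "the `U'_i` shrink to `1`" through `eHat` (a homeomorphism
onto its image, dictionary field `isHomeomorph`).  Everything is `eHat`-plumbing; the mathematical content stays in the
named per-level inputs (HYPOTHESES about the genuine tower; typed ≠ proved); nothing here bears on [IUTchIII] Cor 3.12.
-/

namespace Literature.IUT.HodgeArakelov

open Literature.IUT.HodgeTheaters Topology
open scoped Pointwise

universe u

namespace PlusMinusTower

namespace StableCurveAgreement

variable {S : BadPlaceSetting.{u}} {P : TopGroup.{u}} {T : TemperedCoverings S P}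
  {W : PlusMinusTower T} {C : CuspidalInertiaData W} {D : StableCurveTemperedData.{u}}

/-- **IUTchII:Cor2.4(i)** (kurims p.71 l.1 «the various finite index open subgroups of Δ^±_v») Transport of "the levels
shrink to `1`": if open subgroups `U'_i ≤ Π̂_{X_v}` are eventually inside every neighbourhood of `1`, so are their
pull-backs `ê⁻¹(U'_i) ≤ Π̂^±_v ⊆ Π̂^cor_v` — `eHat` being a homeomorphism `Π̂^±_v ⥲ Π̂_{X_v}` (dictionary field).  PROVED.
[claim: Mochizuki2012, status: disputed] -/
theorem levels_hbasis_of_piHat (A : StableCurveAgreement W C D) (hhomeo : IsHomeomorph A.eHat) {ι : Sort*}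
    (U' : ι → Subgroup D.PiHat) (hbasis' : ∀ O' ∈ 𝓝 (1 : D.PiHat), ∃ i, (U' i : Set D.PiHat) ⊆ O') :
    ∀ O ∈ 𝓝 (1 : W.Corhat), ∃ i,
      ((((U' i).comap A.eHat.toMonoidHom).map W.pmHat.subtype : Subgroup W.Corhat) : Set W.Corhat) ⊆ O := by
  intro O hO
  -- `O ∩ Π̂^±_v` is a neighbourhood of `1` in `Π̂^±_v`; its image under the homeomorphism `eHat` is one of `1` in `Π̂_{X_v}`
  have hO1 : ((↑) : W.pmHat → W.Corhat) ⁻¹' O ∈ 𝓝 (1 : W.pmHat) := continuous_subtype_val.continuousAt hO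
  have hO2 : A.eHat '' (((↑) : W.pmHat → W.Corhat) ⁻¹' O) ∈ 𝓝 (1 : D.PiHat) := by
    rw [← map_one A.eHat]
    exact hhomeo.isOpenMap.image_mem_nhds hO1
  obtain ⟨i, hi⟩ := hbasis' _ hO2
  refine ⟨i, ?_⟩
  rintro _ ⟨q, hq, rfl⟩
  obtain ⟨q', hq', hqq'⟩ := hi (Subgroup.mem_comap.mp hq)
  rw [MulEquiv.coe_toMonoidHom, A.eHat.apply_eq_iff_eq] at hqq'
  subst hqq'
  exact hq'

/-- **IUTchII:Cor2.4(i)** (kurims p.70 l.−2 – p.71 l.3) **The binder `h23vi` of `cor24_i_of_inputs` from per-level [IUTchI]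
§2 data on the `Π̂_{X_v}` side, through the agreement.**  For the target `Π_{v□}` (`H`) with its `Π`- and `Δ`-level
`ℍ`-dictionaries, a subgroup `I` (the node's `I_t ⊆ Π_v`; only `I ∩ Π̂^±_v` enters), levels `U'_i ≤ Π̂_{X_v}` whose pull-backs shrink to
`1` (`hbasis`, cf. `levels_hbasis_of_piHat`), and at each level a `Π̂_{X_v}`-action on the vertex type `V_i`, the component
`□̃_i = comp i ∋ c_i` (`base`: the cusp of `I_t` meets `□̃_i`) and, for tempered geometric `g' ∈ ι(Π^tp_{X_v}) ∩ Δ̂_{X_v}`: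
`incD` — `(ê I)^{g'} ⊆ ι(Π^tp_{X_v,ℍ})` ⇒ `g'·c_i ∈ □̃_i` ([IUTchI] Cor 2.3 (vi) at level `i`, after (i)/(iv));
`blkD` — `g'·□̃_i` meets `□̃_i` ⇒ `g'·□̃_i ⊆ □̃_i` ([CombGC] Prop 1.2 (ii): components are blocks);
`stabD` — `g'` stabilises `□̃_i` ⇒ `g' ∈ ι(Δ^tp_{X_v,ℍ})·U'_i` (decomposition group of `□̃_i`; Cor 2.3 (ii) + `U'_i` open).
CONCLUSION: for `γ' ∈ Δ^±_v`, `I^{γ'} ⊆ Π^±_{v□}` ⇒ `γ' ∈` closure of `Δ^±_{v□}`.  PROVED (`eHat`-plumbing + abc-iut-w5-d121's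
`h23vi_of_levelwise`); all per-level inputs are HYPOTHESES. [claim: Mochizuki2012, status: disputed] -/
theorem h23vi_of_piHatLevelData (A : StableCurveAgreement W C D) {H : Subgroup P}
    (DicPi : A.PiSubgraphDictionary H) (Dic : A.SubgraphDictionary H) {I : Subgroup W.Corhat}
    {ι : Sort*} (U' : ι → Subgroup D.PiHat)
    (hbasis : ∀ O ∈ 𝓝 (1 : W.Corhat), ∃ i,
      ((((U' i).comap A.eHat.toMonoidHom).map W.pmHat.subtype : Subgroup W.Corhat) : Set W.Corhat) ⊆ O)
    (V : ι → Type*) [∀ i, MulAction D.PiHat (V i)] (comp : ∀ i, Set (V i)) (c : ∀ i, V i)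
    (base : ∀ i, c i ∈ comp i)
    (incD : ∀ i (g' : D.PiHat), g' ∈ D.ιX.range → g' ∈ D.DeltaHat →
      MulAut.conj g' • ((I.subgroupOf W.pmHat).map A.eHat.toMonoidHom) ≤ D.piTpXH.map D.ιX → g' • c i ∈ comp i)
    (blkD : ∀ i (g' : D.PiHat), g' ∈ D.ιX.range → g' ∈ D.DeltaHat →
      (∃ v ∈ comp i, g' • v ∈ comp i) → ∀ v ∈ comp i, g' • v ∈ comp i)
    (stabD : ∀ i (g' : D.PiHat), g' ∈ D.ιX.range → g' ∈ D.DeltaHat →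
      (∀ v ∈ comp i, g' • v ∈ comp i) →
        ∃ k' ∈ (D.deltaTpH.map D.ιΔ).map D.DeltaHat.subtype, k'⁻¹ * g' ∈ U' i) :
    ∀ γ' : W.Corhat, γ' ∈ W.piPM ⊓ W.aug.ker →
      I.map (MulAut.conj γ').toMonoidHom ≤ W.pmBox H → γ' ∈ closure (W.deltaPmBox H : Set W.Corhat) := by
  refine W.h23vi_of_levelwise H I (fun i => ((U' i).comap A.eHat.toMonoidHom).map W.pmHat.subtype) hbasis ?_
  intro i γ' hγ' hc
  obtain ⟨hγ'pm', hγ'ker⟩ := Subgroup.mem_inf.mp hγ'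
  have hγ'pm : γ' ∈ W.pmHat := W.emb_le_pmHat hγ'pm'
  set g' : D.PiHat := A.eHat ⟨γ', hγ'pm⟩ with hg'
  have hg'tp : g' ∈ D.ιX.range := (A.mem_piPM_iff ⟨γ', hγ'pm⟩).mp hγ'pm'
  have hg'Δ : g' ∈ D.DeltaHat := (A.mem_ker_iff ⟨γ', hγ'pm⟩).mp hγ'ker
  -- `I^{γ'} ⊆ Π^±_{v□}` transported: `(ê I)^{g'} ⊆ ι(Π^tp_{X,ℍ})`
  have hcD : MulAut.conj g' • ((I.subgroupOf W.pmHat).map A.eHat.toMonoidHom) ≤ D.piTpXH.map D.ιX := by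
    rw [← DicPi.pmBox_eq]
    rintro _ ⟨_, ⟨q, hq, rfl⟩, rfl⟩
    have hqI : (q : W.Corhat) ∈ I := Subgroup.mem_subgroupOf.mp hq
    have hmem : γ' * (q : W.Corhat) * γ'⁻¹ ∈ W.pmBox H := hc ⟨q, hqI, rfl⟩
    have hmem' : γ' * (q : W.Corhat) * γ'⁻¹ ∈ W.pmHat :=
      W.pmHat.mul_mem (W.pmHat.mul_mem hγ'pm q.2) (W.pmHat.inv_mem hγ'pm)
    refine ⟨⟨γ' * (q : W.Corhat) * γ'⁻¹, hmem'⟩, Subgroup.mem_subgroupOf.mpr hmem, ?_⟩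
    change A.eHat _ = MulAut.conj g' • A.eHat q
    rw [MulAut.smul_def, MulAut.conj_apply, hg', ← map_mul, ← map_inv, ← map_mul]
    rfl
  -- the three per-level inputs
  have hinc : g' • c i ∈ comp i := incD i g' hg'tp hg'Δ hcD
  have hstab : ∀ v ∈ comp i, g' • v ∈ comp i := blkD i g' hg'tp hg'Δ ⟨c i, base i, hinc⟩
  obtain ⟨k', hk', hkU⟩ := stabD i g' hg'tp hg'Δ hstab
  -- pull `k' ∈ ι(Δ^tp_{X,ℍ})` back to `k ∈ Δ^±_{v□}`
  rw [← Dic.deltaPmBox_eq] at hk'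
  obtain ⟨k₀, hk₀, rfl⟩ := hk'
  have hk₀box : (k₀ : W.Corhat) ∈ W.deltaPmBox H := Subgroup.mem_subgroupOf.mp hk₀
  refine ⟨k₀, hk₀box, ⟨⟨(k₀ : W.Corhat)⁻¹ * γ', W.pmHat.mul_mem (W.pmHat.inv_mem k₀.2) hγ'pm⟩, ?_, rfl⟩⟩
  change _ ∈ (U' i).comap A.eHat.toMonoidHom
  rw [Subgroup.mem_comap]
  have e1 : A.eHat.toMonoidHom ⟨(k₀ : W.Corhat)⁻¹ * γ', W.pmHat.mul_mem (W.pmHat.inv_mem k₀.2) hγ'pm⟩ =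
      (A.eHat k₀)⁻¹ * g' := by
    rw [hg', ← map_inv, ← map_mul]
    rfl
  rw [e1]
  exact hkU

/-- **IUTchII:Cor2.4(i)** (kurims pp.70–71) `h23vi_of_piHatLevelData` with the levels' shrinking stated on the `Π̂_{X_v}`
side (`hbasis'`) and transported by `levels_hbasis_of_piHat` (dictionary field `isHomeomorph`). PROVED.
[claim: Mochizuki2012, status: disputed] -/
theorem h23vi_of_piHatLevelData' (A : StableCurveAgreement W C D) {H : Subgroup P}
    (DicPi : A.PiSubgraphDictionary H) (Dic : A.SubgraphDictionary H) {I : Subgroup W.Corhat}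
    {ι : Sort*} (U' : ι → Subgroup D.PiHat) (hbasis' : ∀ O' ∈ 𝓝 (1 : D.PiHat), ∃ i, (U' i : Set D.PiHat) ⊆ O')
    (V : ι → Type*) [∀ i, MulAction D.PiHat (V i)] (comp : ∀ i, Set (V i)) (c : ∀ i, V i)
    (base : ∀ i, c i ∈ comp i)
    (incD : ∀ i (g' : D.PiHat), g' ∈ D.ιX.range → g' ∈ D.DeltaHat →
      MulAut.conj g' • ((I.subgroupOf W.pmHat).map A.eHat.toMonoidHom) ≤ D.piTpXH.map D.ιX → g' • c i ∈ comp i)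
    (blkD : ∀ i (g' : D.PiHat), g' ∈ D.ιX.range → g' ∈ D.DeltaHat →
      (∃ v ∈ comp i, g' • v ∈ comp i) → ∀ v ∈ comp i, g' • v ∈ comp i)
    (stabD : ∀ i (g' : D.PiHat), g' ∈ D.ιX.range → g' ∈ D.DeltaHat →
      (∀ v ∈ comp i, g' • v ∈ comp i) →
        ∃ k' ∈ (D.deltaTpH.map D.ιΔ).map D.DeltaHat.subtype, k'⁻¹ * g' ∈ U' i) :
    ∀ γ' : W.Corhat, γ' ∈ W.piPM ⊓ W.aug.ker →
      I.map (MulAut.conj γ').toMonoidHom ≤ W.pmBox H → γ' ∈ closure (W.deltaPmBox H : Set W.Corhat) :=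
  A.h23vi_of_piHatLevelData DicPi Dic U' (A.levels_hbasis_of_piHat Dic.isHomeomorph U' hbasis') V comp c base
    incD blkD stabD

end StableCurveAgreement

end PlusMinusTower

end Literature.IUT.HodgeArakelov
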